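import Summits.BirchSwinnertonDyer.BirchSwinnertonDyer.Theorems.ByReductionTypeAtTwoRankOneAtTwoBigImageOddLocalOneDoorBottomFields
import HarnessLib

/-!
# Route ByReductionTypeAtTwo, crux `RankOneAtTwoBigImageOddLocal` (stmt-BirchSwinnertonDyer-23715), LINE v8.9 `one_door_analytic`:
# the «TWIN COPY OF `y`» case of the cross Čebotarev leaf — `ceb₂'` COMPLETE for the twist equation

Width prover seat `bsd-line-fkl-p2` g10 (2026-08-28), `--supports stmt-BirchSwinnertonDyer-23715` (helper).  THEOREMS ONLY.  BSD is not proved by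
any of this.

`…OneDoorBottomFields.ceb₂'_field_of_ne` serves the field `ceb₂'` of the lead's `FirstDescentInput` (p641630) for a cross pair `(s', y)` whose
restrictions to `K` are DISTINCT.  The remaining class — the twin copy of `y`, `hPsiKT (res s') = res y` (lead's `hceb₂_of_visible₂`: «served
by ANY Kolyvagin prime singular for `y`, because the strict conditions are read after restriction») — needs the dictionary between the
strict condition over `ℚ_ℓ` and over `K_λ` at a Gross–Kolyvagin prime.  Route GenusKolyvaginAtTwo PROVED that dictionary
(`GenusExact.FrobeniusCriterion.zsmul_mem_torsionLocalKer_iff_resTorsion_of_notMem`, for any curve with `Δ < 0` at a good odd inert prime with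
`Frob_ℓ ∼ Frob_∞`) and the `hPsiKT`-invariance of the strict condition (`zsmul_mem_torsionLocalKer_iff_hPsiKT_mem`); this file chains them:

* `not_mem_torsionLocalKer_twist_of_copy` — at a Gross–Kolyvagin prime `ℓ` (`Zhang2014.IsKolyvaginPrime N W K 2 ℓ`, `FrobEqFrobInfty W K 2 ℓ`),
  if `hPsiKT (res s') = res y` and `y ∉ torsionLocalKer_v(W)` then `s' ∉ torsionLocalKer_v(W^{(d_K)})`;
* `ceb₂'_field` — **the field `ceb₂'` for `Kol := kolPrime W K 1`, `pl := pl`, the twist EQUATION `W^{(d_K)}`, with NO restriction on `s'`**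
  (copy case by `ceb₁` + the above; generic case by `ceb₂'_field_of_ne`), unconditional on the `Δ_W < 0` habitat.

References: [McCallumLMS1991] §3 Cor. 3.2 and p. 299; [GrossLMS1991] §§3, 4, 10; [Kolyvagin1989Izv] §3.
-/

set_option autoImplicit false
-- the Theorems namespace of this sub repeats the summit name by design (D-0017 nested layout)
set_option linter.dupNamespace false

noncomputable section

open scoped Classical

namespace Summit.BirchSwinnertonDyer.BirchSwinnertonDyer.Theorems.RankOneAtTwoOneDoor

open WeierstrassCurve NumberField IsDedekindDomain Field Rat.HeightOneSpectrum
open Literature.NumberTheory.EllipticCurves Literature.NumberTheory.GaloisRepresentations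
open Summit.BirchSwinnertonDyer.BirchSwinnertonDyer.Theorems.GenusExact
open Summit.BirchSwinnertonDyer.BirchSwinnertonDyer.Theorems.GenusExact.VisiblePairAtTwo
open Summit.BirchSwinnertonDyer.BirchSwinnertonDyer.Theorems.GenusExact.FrobeniusCriterion
open Summit.BirchSwinnertonDyer.BirchSwinnertonDyer.Theorems.GenusExact.TwinGrossPrimes
open Summit.BirchSwinnertonDyer.BirchSwinnertonDyer.Theorems.GenusExact.SelmerDescent
open Summit.BirchSwinnertonDyer.BirchSwinnertonDyer.Theorems.GenusExact.EigenClassesFinite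

section Rat

variable (N : ℕ) [NeZero N] (W : WeierstrassCurve ℚ) [W.IsElliptic] [W.IsGloballyMinimal]
  {K : Type} [Field K] [NumberField K]

omit [NeZero N] in
/-- **The twin copy of `y` is singular wherever `y` is** (at a Gross–Kolyvagin prime): `W` globally minimal with `Δ_W < 0`, `K = ℚ(θ)`,
`θ² = d_K` odd, `N_W ∣ N`, `ℓ` a Zhang–Kolyvagin prime at `2` of level `N` with `Frob_ℓ ∼ Frob_∞` on `E[2]`, `v ∋ ℓ`; if
`hPsiKT (res s') = res y` then `y ∉ torsionLocalKer_v(W) ⟹ s' ∉ torsionLocalKer_v(W^{(d_K)})`: read both strict conditions at the inert place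
`w ∣ ℓ` of `K` (`zsmul_mem_torsionLocalKer_iff_resTorsion_of_notMem` for `W` and for `W^{(d_K)}`) and move across `hPsiKT`
(`zsmul_mem_torsionLocalKer_iff_hPsiKT_mem`). [cite: McCallumLMS1991, p. 299 and §5 Lemma 5.3] [cite: GrossLMS1991, §4] -/
theorem not_mem_torsionLocalKer_twist_of_copy (hN : W.conductorNorm ℤ ∣ N) (hΔ : W.Δ < 0) (hK : IsImaginaryQuadratic K)
    (hodd : Odd (NumberField.discr K))
    {θ : K} (hθ : θ ∉ Set.range (algebraMap ℚ K)) (hc : θ ^ 2 = algebraMap ℚ K ((NumberField.discr K : ℤ) : ℚ))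
    [(W.quadraticTwist ((NumberField.discr K : ℤ) : ℚ)).IsElliptic]
    {ℓ : ℕ} (hKol : Zhang2014.IsKolyvaginPrime N W K 2 ℓ) (hFrob : FrobEqFrobInfty W K 2 ℓ)
    {v : HeightOneSpectrum (𝓞 ℚ)} (hℓv : (ℓ : 𝓞 ℚ) ∈ v.asIdeal)
    (s' : galH1Torsion (W.quadraticTwist ((NumberField.discr K : ℤ) : ℚ)) ((2 : ℕ) : ℤ)) (y : galH1Torsion W ((2 : ℕ) : ℤ))
    (hcopy : hPsiKT W K hθ hc ((2 : ℕ) : ℤ) (resTorsion (W.quadraticTwist ((NumberField.discr K : ℤ) : ℚ)) K ((2 : ℕ) : ℤ) s') =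
      resTorsion W K ((2 : ℕ) : ℤ) y)
    (hy : y ∉ W.torsionLocalKer (v.adicCompletion ℚ) ((2 : ℕ) : ℤ)) :
    s' ∉ (W.quadraticTwist ((NumberField.discr K : ℤ) : ℚ)).torsionLocalKer (v.adicCompletion ℚ) ((2 : ℕ) : ℤ) := by
  have h2K : Module.finrank ℚ K = 2 := hK.1
  have hd0 : ((NumberField.discr K : ℤ) : ℚ) ≠ 0 := by exact_mod_cast NumberField.discr_ne_zero K
  have hℓ : ℓ.Prime := hKol.1
  have hℓ2 : ℓ ≠ 2 := hKol.2.2.2.1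
  have hℓN : ¬ ℓ ∣ W.conductorNorm ℤ := fun h ↦ hKol.2.1 (h.trans hN)
  have hℓd : ¬ ((ℓ : ℤ) ∣ NumberField.discr K) := hKol.2.2.1
  have hprime : (Ideal.span {(ℓ : 𝓞 K)}).IsPrime := hKol.2.2.2.2.1
  haveI : Fact ℓ.Prime := ⟨hℓ⟩
  have hgoodℓ : W.HasGoodReductionAtPrime ℓ := W.hasGoodReductionAtPrime_of_not_dvd_conductorNorm' hℓN
  have hgood : W.HasGoodReductionAt v := hasGoodReductionAt_of_hasGoodReductionAtPrime W hgoodℓ hℓv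
  have h1C : (1 : VariableChange ℚ) • W.quadraticTwist ((NumberField.discr K : ℤ) : ℚ) =
      W.quadraticTwist ((NumberField.discr K : ℤ) : ℚ) := one_smul _ _
  have hgoodℓ' : (W.quadraticTwist ((NumberField.discr K : ℤ) : ℚ)).HasGoodReductionAtPrime ℓ :=
    hasGoodReductionAtPrime_of_smul_quadraticTwist_eq W h2K hodd _ h1C hℓd hgoodℓ
  have hgood' : (W.quadraticTwist ((NumberField.discr K : ℤ) : ℚ)).HasGoodReductionAt v :=
    hasGoodReductionAt_of_hasGoodReductionAtPrime _ hgoodℓ' hℓv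
  have hΔ' : (W.quadraticTwist ((NumberField.discr K : ℤ) : ℚ)).Δ < 0 := Δ_neg_of_smul_quadraticTwist_eq W hd0 _ h1C hΔ
  have hFrob' : FrobEqFrobInfty (W.quadraticTwist ((NumberField.discr K : ℤ) : ℚ)) K 2 ℓ :=
    frobEqFrobInfty_of_smul_quadraticTwist_eq W hK _ h1C hFrob
  obtain ⟨w, hℓw⟩ := exists_natCast_mem (K := K) hℓ
  have hf := inertiaDeg_eq_two_of_span_isPrime h2K hℓ hprime hℓv hℓw
  haveI : w.asIdeal.LiesOver v.asIdeal := liesOver_of_natCast_mem hℓ hℓv hℓw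
  have hθ' : θ ∉ (algebraMap ℚ K).range := by rwa [RingHom.mem_range, ← Set.mem_range]
  have hcv : (((NumberField.discr K : ℤ) : ℤ) : 𝓞 ℚ) ∉ v.asIdeal := intCast_notMem_of_not_dvd hℓ hℓv hℓd
  intro hs'
  apply hy
  have h1 : (1 : ℤ) • s' ∈ (W.quadraticTwist ((NumberField.discr K : ℤ) : ℚ)).torsionLocalKer (v.adicCompletion ℚ) ((2 : ℕ) : ℤ) := by
    rw [one_zsmul]; exact hs'
  rw [zsmul_mem_torsionLocalKer_iff_resTorsion_of_notMem (W.quadraticTwist _) hΔ' le_rfl (pow_one 2).symm hℓ hℓ2 hℓv hgood' h2K hθ' hc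
    hcv hFrob' w hf s' 1, zsmul_mem_torsionLocalKer_iff_hPsiKT_mem W K hθ hc _ (w.adicCompletion K) _ 1, hcopy,
    ← zsmul_mem_torsionLocalKer_iff_resTorsion_of_notMem W hΔ le_rfl (pow_one 2).symm hℓ hℓ2 hℓv hgood h2K hθ' hc hcv hFrob w hf y 1,
    one_zsmul] at h1
  exact h1

/-- **Field `ceb₂'` for `Kol := kolPrime W K 1`, `pl := pl`, the twist EQUATION `W^{(d_K)}`, ALL non-zero classes `s'`** (unconditional on
the `Δ_W < 0` habitat): the twin copy of `y` is served by a prime singular for `y` (`ceb₁_rat` + `not_mem_torsionLocalKer_twist_of_copy`), every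
other class by `ceb₂'_field_of_ne`.  (The relaxedness hypothesis of the field is not used.) [cite: McCallumLMS1991, §3 Cor. 3.2 and p. 299]
[cite: Kolyvagin1989Izv, §3] -/
theorem ceb₂'_field (hN : W.conductorNorm ℤ ∣ N) (hcm : ¬ W.HasCM) (hΔ : W.Δ < 0) (hK : IsImaginaryQuadratic K)
    (hodd : Odd (NumberField.discr K)) (hns : ¬ IsSquare ((NumberField.discr K : ℚ) * -|W.Δ|))
    (hρ : ∀ n : ℕ, W.HasSurjectiveModNGaloisRep (2 ^ n : ℕ))
    {θ : K} (hθ : θ ∉ Set.range (algebraMap ℚ K)) (hc : θ ^ 2 = algebraMap ℚ K ((NumberField.discr K : ℤ) : ℚ))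
    [(W.quadraticTwist ((NumberField.discr K : ℤ) : ℚ)).IsElliptic]
    (y : galH1Torsion W 2) (hy0 : y ≠ 0) (q₀ : RatPlace) :
    ∀ s' : galH1Torsion (W.quadraticTwist ((NumberField.discr K : ℤ) : ℚ)) 2, s' ≠ 0 →
      (∀ v : RatPlace, v ≠ q₀ → s' ∈ locAt (W.quadraticTwist ((NumberField.discr K : ℤ) : ℚ)) 2 v) →
      ∃ ℓ, kolPrime W K 1 ℓ ∧ s' ∉ strictAt (W.quadraticTwist ((NumberField.discr K : ℤ) : ℚ)) 2 (pl ℓ) ∧ y ∉ strictAt W 2 (pl ℓ) := by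
  intro s' hs0 hrel
  by_cases hcopy : hPsiKT W K hθ hc ((2 : ℕ) : ℤ) (resTorsion (W.quadraticTwist ((NumberField.discr K : ℤ) : ℚ)) K ((2 : ℕ) : ℤ) s') =
      resTorsion W K ((2 : ℕ) : ℤ) y
  · obtain ⟨ℓ, -, hFrob, hKol, hidx, hloc⟩ :=
      ceb₁_rat N W hN hcm hΔ hK hodd hns hρ hθ hc (hinjK_of_habitat W K hK hΔ hρ hns) y hy0 0
    have hyv := hloc _ (natCast_mem_primesEquiv_symm hKol.1)
    refine ⟨ℓ, kolPrime_one_of_isKolyvaginPrime N W hN hK.1 hKol hFrob hidx, ?_, ?_⟩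
    · rw [pl_of_prime hKol.1, strictAt_inl]
      exact not_mem_torsionLocalKer_twist_of_copy N W hN hΔ hK hodd hθ hc hKol hFrob (natCast_mem_primesEquiv_symm hKol.1)
        s' y hcopy hyv
    · rw [pl_of_prime hKol.1, strictAt_inl]
      exact hyv
  · exact ceb₂'_field_of_ne N W hN hcm hΔ hK hodd hns hρ hθ hc y hy0 q₀ s' hs0 hcopy hrel

end Rat

end Summit.BirchSwinnertonDyer.BirchSwinnertonDyer.Theorems.RankOneAtTwoOneDoor

end
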